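import Summits.QuantumFields.YangMills.Theorems.AllWindowsColdBoxBulkMidSandwichLocalisedQCCUncentred
import Summits.QuantumFields.YangMills.Theorems.AllWindowsColdBoxBulkMidLocalToGlobalSandwichH0C2

/-!
# P2 + localised P5 stitched: the C² surrogate of a locally sandwiched potential and its covariance comparison at
# the CORE constant
# (crux idea `logconcave-core-extension` on ⟨stmt-QuantumFields-24006⟩ — the interface the YM-specific piece P1
# `CoreHessianSandwich` has to feed: local second differences `(1 ± r)` on the neighbourhood `U` of the core `K` and the
# Hessian pinching `(1 ± r_K)` of the charted action on an open `V ⊆ K`)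

`surrogate_localisedQuadraticCovarianceComparison`: with the universal constant `C` of
✓`LocalToGlobalSandwich.localToGlobalSandwich_posDef_C2` (p788082): for `H₀ ≻ 0`, `0 ≤ r`, `0 ≤ r_K`, `0 < ρ`,
`C·r ≤ ½`, `r_K ≤ ½`, a nonempty core `K` of `H₀`-diameter `≤ ρ`, an open `U ⊇ K + {vᵀH₀v ≤ 4ρ²}`, an open `V ⊆ K`,
and `Φ ∈ C²` with second differences in `(1 ± r)hᵀH₀h` on `U` and Hessian in `(1 ± r_K)H₀` on `V`, there is a surrogate
`A ∈ C²(ℝⁿ)` with `A = Φ` on `K`, the GLOBAL sandwich `(1 ± C·r)`, and — for all quadratic observables `f, g` —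

  `|gE_A(fg) − gE_A(f)gE_A(g) − rC'| ≤ 168·(r_K + max(C·r, r_K)·μ_A(Vᶜ)^{1/4})·√(rV'_f rV'_g)`

(recentred coefficients `b' = b + 2Hm`, `m` the Gibbs mean of `A`; no centring hypothesis).  The Hessian of `A` on
`V` (an OPEN subset of `K`) is that of `Φ` (`Filter.EventuallyEq.fderiv`), so the localised comparison
`localisedQuadraticCovarianceComparison_uncentred` applies with `δ := max(C·r, r_K)`, `δ_K := r_K`.

HONEST SCOPE.  Free-hands work of the LEAD seat of ⟨stmt-QuantumFields-24006⟩ (FCL lineage) on an ingredient of an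
UN-TRIAGED crux idea card; classical analysis / log-concave probability.  No stub of LINE-18, no crux, rung or summit
is proved; the Yang–Mills mass gap is NOT proved by any of this.
-/

noncomputable section

namespace Summit.QuantumFields.YangMills.Theorems.SandwichVariancePinching

open MeasureTheory Real Set Filter Topology
open scoped Matrix

variable {n : ℕ}

/-- On an open set where two `C²` functions agree, their second derivatives agree. [folklore] -/
theorem hess_eq_of_eqOn_isOpen {A Φ : (Fin n → ℝ) → ℝ} {V : Set (Fin n → ℝ)} (hV : IsOpen V)
    (heq : ∀ x ∈ V, A x = Φ x) {x : Fin n → ℝ} (hx : x ∈ V) (v : Fin n → ℝ) :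
    fderiv ℝ (fderiv ℝ A) x v v = fderiv ℝ (fderiv ℝ Φ) x v v := by
  have h1 : A =ᶠ[𝓝 x] Φ := Filter.eventuallyEq_of_mem (hV.mem_nhds hx) fun y hy => heq y hy
  have h2 : fderiv ℝ A =ᶠ[𝓝 x] fderiv ℝ Φ := h1.fderiv
  rw [h2.fderiv_eq]

/-- **THE SURROGATE AND ITS LOCALISED COVARIANCE COMPARISON** (P2 ∘ localised P5 of the card; see the module
docstring). [folklore] -/
theorem surrogate_localisedQuadraticCovarianceComparison : ∃ C : ℝ, 0 ≤ C ∧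
    ∀ (n : ℕ) (H₀ : Matrix (Fin n) (Fin n) ℝ), H₀.PosDef → ∀ (r rK ρ : ℝ), 0 ≤ r → 0 ≤ rK → 0 < ρ →
      C * r ≤ 1 / 2 → rK ≤ 1 / 2 →
    ∀ (K U V : Set (Fin n → ℝ)), K.Nonempty → IsOpen U → IsOpen V → V ⊆ K →
      (∀ x ∈ K, ∀ y ∈ K, (x - y) ⬝ᵥ H₀ *ᵥ (x - y) ≤ ρ ^ 2) →
      (∀ x ∈ K, ∀ v : Fin n → ℝ, v ⬝ᵥ H₀ *ᵥ v ≤ 4 * ρ ^ 2 → x + v ∈ U) →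
    ∀ (Φ : (Fin n → ℝ) → ℝ), ContDiff ℝ 2 Φ →
      (∀ x h : Fin n → ℝ, x + h ∈ U → x - h ∈ U →
        (1 - r) * (h ⬝ᵥ H₀ *ᵥ h) ≤ Φ (x + h) + Φ (x - h) - 2 * Φ x ∧
          Φ (x + h) + Φ (x - h) - 2 * Φ x ≤ (1 + r) * (h ⬝ᵥ H₀ *ᵥ h)) →
      (∀ x ∈ V, ∀ v : Fin n → ℝ, (1 - rK) * (v ⬝ᵥ H₀ *ᵥ v) ≤ fderiv ℝ (fderiv ℝ Φ) x v v ∧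
        fderiv ℝ (fderiv ℝ Φ) x v v ≤ (1 + rK) * (v ⬝ᵥ H₀ *ᵥ v)) →
    ∃ A : (Fin n → ℝ) → ℝ, ContDiff ℝ 2 A ∧ (∀ x ∈ K, A x = Φ x) ∧
      (∀ x h : Fin n → ℝ, (1 - C * r) * (h ⬝ᵥ H₀ *ᵥ h) ≤ A (x + h) + A (x - h) - 2 * A x ∧
        A (x + h) + A (x - h) - 2 * A x ≤ (1 + C * r) * (h ⬝ᵥ H₀ *ᵥ h)) ∧
      ∀ (Hf Hg : Matrix (Fin n) (Fin n) ℝ) (bf bg : Fin n → ℝ), Hf.IsSymm → Hg.IsSymm →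
        let m : Fin n → ℝ := fun i => (∫ x, x i * exp (-A x)) / ∫ x, exp (-A x)
        let bf' : Fin n → ℝ := bf + (2:ℝ) • Hf *ᵥ m
        let bg' : Fin n → ℝ := bg + (2:ℝ) • Hg *ᵥ m
        |(∫ x, (x ⬝ᵥ Hf *ᵥ x + bf ⬝ᵥ x) * (x ⬝ᵥ Hg *ᵥ x + bg ⬝ᵥ x) * exp (-A x)) / (∫ x, exp (-A x)) -
            (∫ x, (x ⬝ᵥ Hf *ᵥ x + bf ⬝ᵥ x) * exp (-A x)) / (∫ x, exp (-A x)) *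
              ((∫ x, (x ⬝ᵥ Hg *ᵥ x + bg ⬝ᵥ x) * exp (-A x)) / (∫ x, exp (-A x))) -
            (2 * (H₀⁻¹ * Hf * H₀⁻¹ * Hg).trace + bf' ⬝ᵥ H₀⁻¹ *ᵥ bg')| ≤
          168 * (rK + max (C * r) rK * Real.sqrt (Real.sqrt ((∫ x in Vᶜ, exp (-A x)) / ∫ x, exp (-A x)))) *
            Real.sqrt ((2 * (H₀⁻¹ * Hf * H₀⁻¹ * Hf).trace + bf' ⬝ᵥ H₀⁻¹ *ᵥ bf') *
              (2 * (H₀⁻¹ * Hg * H₀⁻¹ * Hg).trace + bg' ⬝ᵥ H₀⁻¹ *ᵥ bg')) := by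
  obtain ⟨C, hC, hP2⟩ := LocalToGlobalSandwich.localToGlobalSandwich_posDef_C2
  refine ⟨C, hC, ?_⟩
  intro n H₀ hH₀ r rK ρ hr hrK hρ hCr hrK2 K U V hKne hU hV hVK hdiam hball Φ hΦ hswU hlocV
  obtain ⟨A, hA, hAK, hAsw⟩ := hP2 n H₀ hH₀ r ρ hr hρ K U hKne hU hdiam hball Φ hΦ hswU
  refine ⟨A, hA, hAK, hAsw, ?_⟩
  intro Hf Hg bf bg hHf hHg
  -- the comparison radius `δ := max (C r) rK`
  set δ : ℝ := max (C * r) rK with hδdef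
  have hδ0 : 0 ≤ δ := le_max_of_le_right hrK
  have hδ2 : δ ≤ 1 / 2 := max_le hCr hrK2
  have hCrδ : C * r ≤ δ := le_max_left _ _
  have hrKδ : rK ≤ δ := le_max_right _ _
  -- the global sandwich at radius `δ`
  have hq0 : ∀ h : Fin n → ℝ, 0 ≤ h ⬝ᵥ H₀ *ᵥ h := fun h => by
    have h0 := hH₀.posSemidef.dotProduct_mulVec_nonneg h
    rwa [star_trivial] at h0
  have hswδ : ∀ x h : Fin n → ℝ, (1 - δ) * (h ⬝ᵥ H₀ *ᵥ h) ≤ A (x + h) + A (x - h) - 2 * A x ∧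
      A (x + h) + A (x - h) - 2 * A x ≤ (1 + δ) * (h ⬝ᵥ H₀ *ᵥ h) := by
    intro x h
    have h1 := hAsw x h
    have hq := hq0 h
    constructor
    · nlinarith [h1.1, mul_le_mul_of_nonneg_right hCrδ hq]
    · nlinarith [h1.2, mul_le_mul_of_nonneg_right hCrδ hq]
  -- the core pinching of `A` on `V` (= that of `Φ`)
  have hlocA : ∀ x ∈ V, ∀ v : Fin n → ℝ, (1 - rK) * (v ⬝ᵥ H₀ *ᵥ v) ≤ fderiv ℝ (fderiv ℝ A) x v v ∧
      fderiv ℝ (fderiv ℝ A) x v v ≤ (1 + rK) * (v ⬝ᵥ H₀ *ᵥ v) := by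
    intro x hx v
    rw [hess_eq_of_eqOn_isOpen hV (fun y hy => hAK y (hVK hy)) hx v]
    exact hlocV x hx v
  exact localisedQuadraticCovarianceComparison_uncentred hH₀ hδ0 hδ2 hrK hrKδ Hf Hg bf bg hHf hHg hA hswδ
    hV.measurableSet hlocA

end Summit.QuantumFields.YangMills.Theorems.SandwichVariancePinching

end
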